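import Mathlib.Combinatorics.SimpleGraph.Finite
import Mathlib.Data.Finset.Sym
import Mathlib.Order.SymmDiff
import Mathlib.Algebra.BigOperators.Group.Finset.Basic
import Mathlib.Algebra.Order.Group.Nat
import Mathlib.Logic.Function.Iterate
import Mathlib.Order.WellFoundedSet
import Mathlib.Algebra.Ring.Parity
import HarnessLib

/-!
# Deterministic exploration of an edge set: the backbone of Aizenman–Fernández's random-walk representation

Topic `Probability/LatticeModels`, namespace `Literature.Probability.LatticeModels`. Pure finite
combinatorics, third layer of the proof of the Aizenman–Fernández differential inequalities
(J. Stat. Phys. 44 (1986) 393–454): the **backbone** of §4 ("The random walk representation"),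
Definitions 4.1–4.3: "at each site `x` we choose an order for the set of steps emerging from `x` …
Each step `(xᵢ, xᵢ₊₁)` is the earliest of all steps emerging from `xᵢ` that have not been cancelled by
previous steps, and for which the flux number is odd … The path stops when it reaches a site from
which there are no more non-cancelled bonds with odd flux number available."

In the high-temperature (parity) picture a current is the set `F` of its odd bonds dressed with even
multiplicities (Aizenman–Fernández 1986, (4.4)–(4.5): the weights `ρ(ω)` only see `tanh(βJ_b)` on
the bonds of `ω` and the event "`n_b` even on the cancelled bonds"), so the backbone is a function of
a finite **edge set** `F`. This file defines that function and proves its structural properties,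
for an arbitrary finite set `E` of (non-diagonal) unordered pairs over a vertex type `W`, a ranking
`rk` of the pairs (injective on `E`; it replaces the "order for the set of steps emerging from `x`")
and a set `T` of stopping vertices (in the application `T ∋ g`: "if they reach an `h`-site they
stop there", ibid. after Def. 4.2):

* `EWState`, `ewStep`, `ewIter`, `ewRun` — the walk: from the current vertex examine the unused
  pairs of `E` at it in the order `rk`; the first one lying in `F` is *traversed* (the walk moves to
  its other end), the lower-ranked ones are *cancelled* (marked used); at a vertex of `T`, or when no
  unused pair at the vertex lies in `F`, the walk halts (Def. 4.2 (P1)–(P3));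
* `ewIter_congr` (**locality**, ibid. §4.2, proof of (b): the walk reads `F` only on the bonds it
  cancels) and `inter_used_eq_trav` (the traversed bonds are exactly the bonds of `F` among the
  cancelled ones);
* `odd_travDeg_iff` (the traversed bonds form a trail from the start to the current vertex),
  `ewRun_halt` (the walk halts within `|E| + 1` steps) and `ewRun_pos_mem` (**Def. 4.2 (P3)**: "This
  always happens at a source": if every odd vertex of `F` other than the start lies in `T`, the walk
  ends in `T`);
* `ewRun_erase_pos_eq` (**surgery**, the step behind Prop. 4.6, eq. (4.21), "splitting from the
  paths their last step"): if the walk of `F` traverses the pair `e` from the vertex `a`, the walk of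
  `F ∖ {e}` with the additional stopping vertex `a` ends at `a`.

## References

* M. Aizenman, R. Fernández, J. Stat. Phys. 44 (1986) 393–454, §4.1 (Definitions 4.1–4.3),
  §4.2 (Prop. 4.4 (b)), §4.3 (Prop. 4.6, eq. (4.21)) [AizenmanFernandezJSP1986].
* M. Aizenman, Comm. Math. Phys. 86 (1982) 1–48, §9 (the random-walk representation) — the tree's
  `CurrentExploration.lean` formalises that walk for currents on a finite graph; the present file is
  its parity version for edge sets, written independently of graph structure.
-/

namespace Literature.Probability.LatticeModels

open Finset

section EdgeWalk

variable {W : Type*} [DecidableEq W]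

/-! ### The other endpoint of a pair -/

/-- The other endpoint of the pair `e` seen from `p` (`p` itself if `p ∉ e`). [folklore] -/
def edgeOther (p : W) (e : Sym2 W) : W :=
  Sym2.lift ⟨fun a b => if a = p then b else if b = p then a else p, fun a b => by
    by_cases ha : a = p <;> by_cases hb : b = p <;> simp [ha, hb]⟩ e

/-- `edgeOther p s(p, q) = q`. [folklore] -/
@[simp] theorem edgeOther_mk_left (p q : W) : edgeOther p s(p, q) = q := by
  simp [edgeOther]

/-- `edgeOther p s(q, p) = q`. [folklore] -/
@[simp] theorem edgeOther_mk_right (p q : W) : edgeOther p s(q, p) = q := by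
  rw [Sym2.eq_swap]; exact edgeOther_mk_left p q

/-- `s(p, edgeOther p e) = e` for `p ∈ e`. [folklore] -/
theorem mk_edgeOther_eq {p : W} {e : Sym2 W} (h : p ∈ e) : s(p, edgeOther p e) = e := by
  induction e using Sym2.ind with
  | _ a b =>
    rcases Sym2.mem_iff.1 h with rfl | rfl
    · rw [edgeOther_mk_left]
    · rw [edgeOther_mk_right, Sym2.eq_swap]

/-- The other endpoint belongs to the pair. [folklore] -/
theorem edgeOther_mem {p : W} {e : Sym2 W} (h : p ∈ e) : edgeOther p e ∈ e := by
  have := Sym2.mem_mk_right p (edgeOther p e)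
  rwa [mk_edgeOther_eq h] at this

/-- For a non-diagonal pair the other endpoint differs from `p`. [folklore] -/
theorem edgeOther_ne {p : W} {e : Sym2 W} (h : p ∈ e) (hd : ¬e.IsDiag) : edgeOther p e ≠ p := by
  intro heq
  rw [← mk_edgeOther_eq h, heq] at hd
  exact hd rfl

/-- Membership in a pair through one endpoint and the other one. [folklore] -/
theorem mem_iff_eq_or_eq_edgeOther {p : W} {e : Sym2 W} (h : p ∈ e) (w : W) :
    w ∈ e ↔ w = p ∨ w = edgeOther p e := by
  conv_lhs => rw [← mk_edgeOther_eq h]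
  exact Sym2.mem_iff

/-! ### States and one step -/

/-- A state of the walk: current vertex, cancelled ("used") pairs, traversed pairs, halting flag. [cite: AizenmanFernandezJSP1986, §4.1, Definitions 4.1–4.2] -/
structure EWState (W : Type*) where
  /-- current vertex -/
  pos : W
  /-- cancelled pairs (examined and skipped, or traversed) -/
  used : Finset (Sym2 W)
  /-- traversed pairs -/
  trav : Finset (Sym2 W)
  /-- halting flag -/
  halt : Bool

variable (E : Finset (Sym2 W)) (rk : Sym2 W → ℕ)

/-- The initial state at `v`. [folklore] -/
def ewInit (v : W) : EWState W := ⟨v, ∅, ∅, false⟩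

/-- The pairs of `E` at the current vertex not yet cancelled. [cite: AizenmanFernandezJSP1986, §4.1, Definition 4.1] -/
def ewUnused (σ : EWState W) : Finset (Sym2 W) := E.filter fun e => σ.pos ∈ e ∧ e ∉ σ.used

/-- The pairs the walk may traverse: the uncancelled pairs at the current vertex lying in `F`
("non-cancelled bonds with odd flux number", Def. 4.2 (P2)). [cite: AizenmanFernandezJSP1986, §4.1, Definition 4.2 (P2)] -/
def ewAvail (F : Finset (Sym2 W)) (σ : EWState W) : Finset (Sym2 W) := (ewUnused E σ).filter (· ∈ F)

/-- Traversing the pair `e`: move to its other end, cancel `e` and the uncancelled pairs at the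
vertex ranked below it (Def. 4.1: "all the bonds corresponding to steps emerging from `x` that are
earlier than `(x,y)`"), record `e` as traversed. [cite: AizenmanFernandezJSP1986, §4.1, Definition 4.1] -/
def ewAdvance (σ : EWState W) (e : Sym2 W) : EWState W :=
  ⟨edgeOther σ.pos e, σ.used ∪ (ewUnused E σ).filter (fun e' => rk e' ≤ rk e), insert e σ.trav, false⟩

/-- The stuck state: no uncancelled pair at the vertex lies in `F`; they are all cancelled and the
walk halts (Def. 4.2 (P3)). [cite: AizenmanFernandezJSP1986, §4.1, Definition 4.2 (P3)] -/
def ewStuck (σ : EWState W) : EWState W :=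
  { σ with used := σ.used ∪ ewUnused E σ, halt := true }

/-- **One step of the walk** with odd pairs `F` and stopping set `T`: a halted state is fixed; at a
vertex of `T` the walk halts; otherwise it traverses the available pair of least rank, or gets stuck. [cite: AizenmanFernandezJSP1986, §4.1, Definition 4.2 (P1)–(P3)] -/
noncomputable def ewStep (F : Finset (Sym2 W)) (T : Finset W) (σ : EWState W) : EWState W :=
  if σ.halt then σ
  else if σ.pos ∈ T then { σ with halt := true }
  else if h : (ewAvail E F σ).Nonempty then
    ewAdvance E rk σ (Function.argminOn rk (↑(ewAvail E F σ) : Set (Sym2 W)) h)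
  else ewStuck E σ

/-- The `n`-th state of the walk from `σ₀`. [folklore] -/
noncomputable def ewIter (F : Finset (Sym2 W)) (T : Finset W) (σ₀ : EWState W) (n : ℕ) : EWState W :=
  (ewStep E rk F T)^[n] σ₀

/-- **The walk** from the vertex `v`: `|E| + 1` steps (enough to halt). [cite: AizenmanFernandezJSP1986, §4.1, Definition 4.2] -/
noncomputable def ewRun (F : Finset (Sym2 W)) (T : Finset W) (v : W) : EWState W :=
  ewIter E rk F T (ewInit v) (E.card + 1)

variable {E rk}

/-- `ewIter` at `0`. [folklore] -/
@[simp] theorem ewIter_zero (F : Finset (Sym2 W)) (T : Finset W) (σ₀ : EWState W) :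
    ewIter E rk F T σ₀ 0 = σ₀ := rfl

/-- `ewIter` at `n + 1`. [folklore] -/
theorem ewIter_succ (F : Finset (Sym2 W)) (T : Finset W) (σ₀ : EWState W) (n : ℕ) :
    ewIter E rk F T σ₀ (n + 1) = ewStep E rk F T (ewIter E rk F T σ₀ n) :=
  Function.iterate_succ_apply' _ _ _

/-- `ewIter` composes: iterating `n` more steps from the `m`-th state. [folklore] -/
theorem ewIter_add (F : Finset (Sym2 W)) (T : Finset W) (σ₀ : EWState W) (m n : ℕ) :
    ewIter E rk F T σ₀ (m + n) = ewIter E rk F T (ewIter E rk F T σ₀ m) n := by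
  rw [ewIter, ewIter, ewIter, add_comm, Function.iterate_add_apply]

/-! ### Case analysis of one step -/

/-- Membership in the uncancelled pairs at the vertex. [folklore] -/
theorem mem_ewUnused {σ : EWState W} {e : Sym2 W} :
    e ∈ ewUnused E σ ↔ e ∈ E ∧ σ.pos ∈ e ∧ e ∉ σ.used := by
  simp [ewUnused]

/-- Membership in the available pairs. [folklore] -/
theorem mem_ewAvail {F : Finset (Sym2 W)} {σ : EWState W} {e : Sym2 W} :
    e ∈ ewAvail E F σ ↔ (e ∈ E ∧ σ.pos ∈ e ∧ e ∉ σ.used) ∧ e ∈ F := by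
  simp [ewAvail, mem_ewUnused]

/-- A halted state is fixed. [folklore] -/
theorem ewStep_of_halt {F : Finset (Sym2 W)} {T : Finset W} {σ : EWState W} (h : σ.halt = true) :
    ewStep E rk F T σ = σ := by
  simp [ewStep, h]

/-- At a stopping vertex the walk halts. [folklore] -/
theorem ewStep_of_mem {F : Finset (Sym2 W)} {T : Finset W} {σ : EWState W} (h : σ.halt = false)
    (hT : σ.pos ∈ T) : ewStep E rk F T σ = { σ with halt := true } := by
  simp [ewStep, h, hT]

/-- With an available pair the walk traverses the one of least rank. [folklore] -/
theorem ewStep_of_nonempty {F : Finset (Sym2 W)} {T : Finset W} {σ : EWState W} (h : σ.halt = false)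
    (hT : σ.pos ∉ T) (hA : (ewAvail E F σ).Nonempty) :
    ewStep E rk F T σ = ewAdvance E rk σ (Function.argminOn rk (↑(ewAvail E F σ) : Set (Sym2 W)) hA) := by
  simp [ewStep, h, hT, hA]

/-- Without available pairs the walk is stuck. [folklore] -/
theorem ewStep_of_empty {F : Finset (Sym2 W)} {T : Finset W} {σ : EWState W} (h : σ.halt = false)
    (hT : σ.pos ∉ T) (hA : ¬(ewAvail E F σ).Nonempty) : ewStep E rk F T σ = ewStuck E σ := by
  simp [ewStep, h, hT, hA]

/-- The four cases of a step. [folklore] -/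
theorem ewStep_cases (F : Finset (Sym2 W)) (T : Finset W) (σ : EWState W) :
    (σ.halt = true ∧ ewStep E rk F T σ = σ) ∨
    (σ.halt = false ∧ σ.pos ∈ T ∧ ewStep E rk F T σ = { σ with halt := true }) ∨
    (σ.halt = false ∧ σ.pos ∉ T ∧ ∃ hA : (ewAvail E F σ).Nonempty,
      ewStep E rk F T σ = ewAdvance E rk σ (Function.argminOn rk (↑(ewAvail E F σ) : Set (Sym2 W)) hA)) ∨
    (σ.halt = false ∧ σ.pos ∉ T ∧ ¬(ewAvail E F σ).Nonempty ∧ ewStep E rk F T σ = ewStuck E σ) := by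
  by_cases h : σ.halt = true
  · exact Or.inl ⟨h, ewStep_of_halt h⟩
  rw [Bool.not_eq_true] at h
  by_cases hT : σ.pos ∈ T
  · exact Or.inr (Or.inl ⟨h, hT, ewStep_of_mem h hT⟩)
  by_cases hA : (ewAvail E F σ).Nonempty
  · exact Or.inr (Or.inr (Or.inl ⟨h, hT, hA, ewStep_of_nonempty h hT hA⟩))
  · exact Or.inr (Or.inr (Or.inr ⟨h, hT, hA, ewStep_of_empty h hT hA⟩))

/-- The traversed pair is available, and no available pair has smaller rank. [folklore] -/
theorem argminOn_mem_ewAvail {F : Finset (Sym2 W)} {σ : EWState W} (hA : (ewAvail E F σ).Nonempty) :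
    Function.argminOn rk (↑(ewAvail E F σ) : Set (Sym2 W)) hA ∈ ewAvail E F σ :=
  Function.argminOn_mem rk _ hA

/-- Bookkeeping: the rank of the traversed pair is minimal among the available pairs. [folklore] -/
theorem rk_argminOn_le {F : Finset (Sym2 W)} {σ : EWState W} (hA : (ewAvail E F σ).Nonempty)
    {e : Sym2 W} (he : e ∈ ewAvail E F σ) :
    rk (Function.argminOn rk (↑(ewAvail E F σ) : Set (Sym2 W)) hA) ≤ rk e :=
  Function.argminOn_le rk (↑(ewAvail E F σ) : Set (Sym2 W)) (mem_coe.2 he)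

/-! ### Monotonicity -/

/-- Cancelled pairs only grow in a step. [folklore] -/
theorem used_subset_ewStep (F : Finset (Sym2 W)) (T : Finset W) (σ : EWState W) :
    σ.used ⊆ (ewStep E rk F T σ).used := by
  rcases ewStep_cases (E := E) (rk := rk) F T σ with ⟨-, h⟩ | ⟨-, -, h⟩ | ⟨-, -, hA, h⟩ | ⟨-, -, -, h⟩ <;>
    rw [h]
  · exact subset_union_left
  · exact subset_union_left

/-- Traversed pairs only grow in a step. [folklore] -/
theorem trav_subset_ewStep (F : Finset (Sym2 W)) (T : Finset W) (σ : EWState W) :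
    σ.trav ⊆ (ewStep E rk F T σ).trav := by
  rcases ewStep_cases (E := E) (rk := rk) F T σ with ⟨-, h⟩ | ⟨-, -, h⟩ | ⟨-, -, hA, h⟩ | ⟨-, -, -, h⟩ <;>
    rw [h]
  · exact subset_insert _ _
  · rfl

/-- Cancelled pairs only grow along the walk. [folklore] -/
theorem used_mono_ewIter (F : Finset (Sym2 W)) (T : Finset W) (σ₀ : EWState W) {m n : ℕ} (h : m ≤ n) :
    (ewIter E rk F T σ₀ m).used ⊆ (ewIter E rk F T σ₀ n).used := by
  induction h with
  | refl => rfl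
  | step _ ih => rw [ewIter_succ]; exact ih.trans (used_subset_ewStep F T _)

/-- Traversed pairs only grow along the walk. [folklore] -/
theorem trav_mono_ewIter (F : Finset (Sym2 W)) (T : Finset W) (σ₀ : EWState W) {m n : ℕ} (h : m ≤ n) :
    (ewIter E rk F T σ₀ m).trav ⊆ (ewIter E rk F T σ₀ n).trav := by
  induction h with
  | refl => rfl
  | step _ ih => rw [ewIter_succ]; exact ih.trans (trav_subset_ewStep F T _)

/-- Once halted the walk is fixed. [folklore] -/
theorem ewIter_eq_of_halt {F : Finset (Sym2 W)} {T : Finset W} {σ₀ : EWState W} {m : ℕ}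
    (h : (ewIter E rk F T σ₀ m).halt = true) {n : ℕ} (hmn : m ≤ n) : ewIter E rk F T σ₀ n = ewIter E rk F T σ₀ m := by
  induction hmn with
  | refl => rfl
  | step _ ih => rw [ewIter_succ, ih, ewStep_of_halt h]

/-- The halting flag is monotone. [folklore] -/
theorem halt_mono_ewIter {F : Finset (Sym2 W)} {T : Finset W} {σ₀ : EWState W} {m n : ℕ} (hmn : m ≤ n)
    (h : (ewIter E rk F T σ₀ m).halt = true) : (ewIter E rk F T σ₀ n).halt = true := by
  rw [ewIter_eq_of_halt h hmn]; exact h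

/-- If the walk has not halted at time `n`, it had not halted before. [folklore] -/
theorem halt_eq_false_of_le {F : Finset (Sym2 W)} {T : Finset W} {σ₀ : EWState W} {m n : ℕ} (hmn : m ≤ n)
    (h : (ewIter E rk F T σ₀ n).halt = false) : (ewIter E rk F T σ₀ m).halt = false := by
  by_contra h'
  rw [Bool.not_eq_false] at h'
  rw [halt_mono_ewIter hmn h'] at h
  exact Bool.noConfusion h

/-! ### The invariant: traversed pairs are the pairs of `F` among the cancelled ones -/

/-- The structural invariant of a state relative to `F`: traversed pairs lie in `F ∩ E` and are
cancelled, cancelled pairs lie in `E`, and a cancelled pair of `F` has been traversed. [cite: AizenmanFernandezJSP1986, §4.2, proof of Prop. 4.4 (b)] -/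
structure EWInv (E F : Finset (Sym2 W)) (σ : EWState W) : Prop where
  trav_subset_F : σ.trav ⊆ F
  trav_subset_used : σ.trav ⊆ σ.used
  used_subset_E : σ.used ⊆ E
  trav_of_used : ∀ e ∈ σ.used, e ∈ F → e ∈ σ.trav

omit [DecidableEq W] in
/-- The initial state satisfies the invariant. [folklore] -/
theorem ewInv_init (F : Finset (Sym2 W)) (v : W) : EWInv E F (ewInit v) :=
  ⟨empty_subset _, empty_subset _, empty_subset _, fun _ he => absurd he (notMem_empty _)⟩

/-- One step preserves the invariant, provided `rk` is injective on `E`. [cite: AizenmanFernandezJSP1986, §4.2, proof of Prop. 4.4 (b)] -/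
theorem ewInv_step {F : Finset (Sym2 W)} (hrk : Set.InjOn rk ↑E) (T : Finset W) {σ : EWState W}
    (h : EWInv E F σ) : EWInv E F (ewStep E rk F T σ) := by
  rcases ewStep_cases (E := E) (rk := rk) F T σ with ⟨-, hs⟩ | ⟨-, -, hs⟩ | ⟨-, -, hA, hs⟩ | ⟨-, -, hA, hs⟩ <;>
    rw [hs]
  · exact h
  · exact ⟨h.1, h.2, h.3, h.4⟩
  · set e := Function.argminOn rk (↑(ewAvail E F σ) : Set (Sym2 W)) hA with he
    have heA := argminOn_mem_ewAvail (E := E) (rk := rk) hA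
    rw [← he, mem_ewAvail] at heA
    refine ⟨?_, ?_, ?_, ?_⟩
    · exact insert_subset heA.2 h.1
    · intro e' he'
      rcases mem_insert.1 he' with rfl | he'
      · exact mem_union_right _ (mem_filter.2 ⟨mem_ewUnused.2 heA.1, le_rfl⟩)
      · exact mem_union_left _ (h.2 he')
    · exact union_subset h.3 ((filter_subset _ _).trans (filter_subset _ _))
    · intro e' he' he'F
      simp only [ewAdvance] at he' ⊢
      rcases mem_union.1 he' with he' | he'
      · exact mem_insert_of_mem (h.4 e' he' he'F)
      · rw [mem_filter] at he'
        have he'A : e' ∈ ewAvail E F σ := mem_ewAvail.2 ⟨mem_ewUnused.1 he'.1, he'F⟩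
        have hle := rk_argminOn_le (E := E) (rk := rk) hA he'A
        rw [← he] at hle
        have heq : e' = e := hrk ((mem_ewUnused.1 he'.1).1) heA.1.1 (le_antisymm he'.2 hle)
        rw [heq]
        exact mem_insert_self _ _
  · refine ⟨h.1, fun e' he' => mem_union_left _ (h.2 he'), union_subset h.3 (filter_subset _ _), ?_⟩
    intro e' he' he'F
    simp only [ewStuck] at he' ⊢
    rcases mem_union.1 he' with he' | he'
    · exact h.4 e' he' he'F
    · exact absurd ⟨e', mem_filter.2 ⟨he', he'F⟩⟩ hA

/-- The invariant holds along the walk. [folklore] -/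
theorem ewInv_iter {F : Finset (Sym2 W)} (hrk : Set.InjOn rk ↑E) (T : Finset W) {σ₀ : EWState W}
    (h : EWInv E F σ₀) (n : ℕ) : EWInv E F (ewIter E rk F T σ₀ n) := by
  induction n with
  | zero => exact h
  | succ n ih => rw [ewIter_succ]; exact ewInv_step hrk T ih

/-- **The traversed pairs are exactly the pairs of `F` cancelled by the walk** (given the invariant
initially; Aizenman–Fernández 1986, §4.2: the currents contributing to `ρ(ω)` "are odd on all bonds in
`ω`" and "even on all bonds in `ω̃ ∖ ω`"). [cite: AizenmanFernandezJSP1986, §4.2, conditions (i)–(ii) before (4.4)] -/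
theorem inter_used_eq_trav {F : Finset (Sym2 W)} (hrk : Set.InjOn rk ↑E) (T : Finset W) {σ₀ : EWState W}
    (h : EWInv E F σ₀) (n : ℕ) : F ∩ (ewIter E rk F T σ₀ n).used = (ewIter E rk F T σ₀ n).trav := by
  have hI := ewInv_iter hrk T h n
  ext e
  rw [mem_inter]
  exact ⟨fun ⟨heF, heU⟩ => hI.4 e heU heF, fun he => ⟨hI.1 he, hI.2 he⟩⟩

/-! ### Locality -/

/-- **Locality of one step**: if `F` and `F'` agree on the pairs cancelled after the step, the steps
agree (the walk only reads `F` on the bonds it cancels; Aizenman–Fernández 1986, §4.2, proof of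
(b): the configuration off `ω̃₁` is free). [cite: AizenmanFernandezJSP1986, §4.2, proof of Prop. 4.4 (b)] -/
theorem ewStep_congr (hrk : Set.InjOn rk ↑E) {F F' : Finset (Sym2 W)} {T : Finset W} {σ : EWState W}
    (h : ∀ e ∈ (ewStep E rk F T σ).used, e ∈ F ↔ e ∈ F') : ewStep E rk F' T σ = ewStep E rk F T σ := by
  rcases ewStep_cases (E := E) (rk := rk) F T σ with ⟨hh, hs⟩ | ⟨hh, hT, hs⟩ | ⟨hh, hT, hA, hs⟩ | ⟨hh, hT, hA, hs⟩
  · rw [hs, ewStep_of_halt hh]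
  · rw [hs, ewStep_of_mem hh hT]
  · rw [hs] at h ⊢
    set e := Function.argminOn rk (↑(ewAvail E F σ) : Set (Sym2 W)) hA with he
    have heA := argminOn_mem_ewAvail (E := E) (rk := rk) hA
    rw [← he] at heA
    -- `e` is available for `F'` as well
    have heA' : e ∈ ewAvail E F' σ := by
      rw [mem_ewAvail] at heA ⊢
      refine ⟨heA.1, (h e ?_).1 heA.2⟩
      exact mem_union_right _ (mem_filter.2 ⟨mem_ewUnused.2 heA.1, le_rfl⟩)
    have hA' : (ewAvail E F' σ).Nonempty := ⟨e, heA'⟩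
    rw [ewStep_of_nonempty hh hT hA']
    -- and it is the pair of least rank available for `F'`
    suffices heq : Function.argminOn rk (↑(ewAvail E F' σ) : Set (Sym2 W)) hA' = e by rw [heq]
    set e' := Function.argminOn rk (↑(ewAvail E F' σ) : Set (Sym2 W)) hA' with he'
    have he'A := argminOn_mem_ewAvail (E := E) (rk := rk) hA'
    rw [← he'] at he'A
    have h1 : rk e' ≤ rk e := by rw [he']; exact rk_argminOn_le hA' heA'
    -- `e'` is cancelled in the `F`-step, hence `F` and `F'` agree on it, so it is available for `F`
    have he'U : e' ∈ (ewAdvance E rk σ e).used :=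
      mem_union_right _ (mem_filter.2 ⟨mem_ewUnused.2 (mem_ewAvail.1 he'A).1, h1⟩)
    have he'F : e' ∈ ewAvail E F σ :=
      mem_ewAvail.2 ⟨(mem_ewAvail.1 he'A).1, (h e' he'U).2 (mem_ewAvail.1 he'A).2⟩
    have h2 : rk e ≤ rk e' := by rw [he]; exact rk_argminOn_le hA he'F
    exact hrk (mem_ewAvail.1 he'A).1.1 (mem_ewAvail.1 heA).1.1 (le_antisymm h1 h2)
  · rw [hs] at h ⊢
    have hA' : ¬(ewAvail E F' σ).Nonempty := by
      rintro ⟨e, he⟩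
      refine hA ⟨e, mem_ewAvail.2 ⟨(mem_ewAvail.1 he).1, (h e ?_).2 (mem_ewAvail.1 he).2⟩⟩
      simp only [ewStuck]
      exact mem_union_right _ (mem_ewUnused.2 (mem_ewAvail.1 he).1)
    rw [ewStep_of_empty hh hT hA']

/-- **Locality of the walk** (from any initial state): if `F` and `F'` agree on the pairs cancelled
by the `F`-walk up to time `n`, the two walks agree up to time `n`. [cite: AizenmanFernandezJSP1986, §4.2, proof of Prop. 4.4 (b)] -/
theorem ewIter_congr (hrk : Set.InjOn rk ↑E) {F F' : Finset (Sym2 W)} {T : Finset W} {σ₀ : EWState W} {n : ℕ}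
    (h : ∀ e ∈ (ewIter E rk F T σ₀ n).used, e ∈ F ↔ e ∈ F') :
    ∀ m ≤ n, ewIter E rk F' T σ₀ m = ewIter E rk F T σ₀ m := by
  intro m hm
  induction m with
  | zero => rfl
  | succ m ih =>
    have ih' := ih (Nat.le_of_succ_le hm)
    rw [ewIter_succ, ewIter_succ, ih']
    refine ewStep_congr hrk fun e he => h e ?_
    rw [← ewIter_succ] at he
    exact used_mono_ewIter F T σ₀ hm he

/-! ### The chosen pair of a traversing step -/

/-- In a traversing step the new state is `ewAdvance` at the pair of least rank; we name the facts
about that pair. [folklore] -/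
theorem ewStep_traverse_spec {F : Finset (Sym2 W)} {T : Finset W} {σ : EWState W} (hh : σ.halt = false)
    (hT : σ.pos ∉ T) (hA : (ewAvail E F σ).Nonempty) :
    let e := Function.argminOn rk (↑(ewAvail E F σ) : Set (Sym2 W)) hA
    ewStep E rk F T σ = ewAdvance E rk σ e ∧ e ∈ E ∧ σ.pos ∈ e ∧ e ∉ σ.used ∧ e ∈ F ∧
      ∀ e' ∈ ewAvail E F σ, rk e ≤ rk e' := by
  have heA := argminOn_mem_ewAvail (E := E) (rk := rk) hA
  rw [mem_ewAvail] at heA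
  exact ⟨ewStep_of_nonempty hh hT hA, heA.1.1, heA.1.2.1, heA.1.2.2, heA.2, fun e' he' => rk_argminOn_le hA he'⟩

/-! ### The traversed pairs form a trail -/

/-- The number of traversed pairs at the vertex `p`. [folklore] -/
def travDeg (σ : EWState W) (p : W) : ℕ := #(σ.trav.filter fun e => p ∈ e)

/-- **The traversed pairs form a trail from the start to the current vertex**: along the walk from
`v`, the vertex `p` has odd traversed degree iff exactly one of `p = v`, `p = current vertex` holds
(pairs of `E` being non-diagonal). [cite: AizenmanFernandezJSP1986, §4.1, the definition of the lattice sources ∂ω of a step sequence] -/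
theorem odd_travDeg_iff (hrk : Set.InjOn rk ↑E) (hE : ∀ e ∈ E, ¬(e : Sym2 W).IsDiag) (F : Finset (Sym2 W))
    (T : Finset W) (v : W) (n : ℕ) (p : W) :
    Odd (travDeg (ewIter E rk F T (ewInit v) n) p) ↔ ¬(p = v ↔ p = (ewIter E rk F T (ewInit v) n).pos) := by
  induction n generalizing p with
  | zero =>
    simp [travDeg, ewInit, ewIter]
  | succ n ih =>
    set σ := ewIter E rk F T (ewInit v) n with hσ
    rw [ewIter_succ, ← hσ]
    rcases ewStep_cases (E := E) (rk := rk) F T σ with ⟨-, hs⟩ | ⟨-, -, hs⟩ | ⟨hh, hT, hA, hs⟩ | ⟨-, -, -, hs⟩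
    · rw [hs]; exact ih p
    · rw [hs]; exact ih p
    · obtain ⟨hstep, heE, hpe, heU, -, -⟩ := ewStep_traverse_spec (E := E) (rk := rk) hh hT hA
      set e := Function.argminOn rk (↑(ewAvail E F σ) : Set (Sym2 W)) hA with he
      rw [hstep]
      have hI := ewInv_iter hrk T (ewInv_init (E := E) F v) n
      rw [← hσ] at hI
      have heT : e ∉ σ.trav := fun h => heU (hI.2 h)
      have hq : edgeOther σ.pos e ≠ σ.pos := edgeOther_ne hpe (hE e heE)
      -- the new traversed degree
      have hdeg : travDeg (ewAdvance E rk σ e) p = travDeg σ p + if p ∈ e then 1 else 0 := by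
        simp only [travDeg, ewAdvance]
        rw [filter_insert]
        split_ifs with hp
        · rw [card_insert_of_notMem (fun h => heT (mem_filter.1 h).1)]
        · rw [add_zero]
      rw [hdeg]
      show Odd (travDeg σ p + if p ∈ e then 1 else 0) ↔ ¬(p = v ↔ p = edgeOther σ.pos e)
      have hmem := mem_iff_eq_or_eq_edgeOther hpe p
      have ihp := ih p
      by_cases hp : p ∈ e
      · rw [if_pos hp, Nat.odd_add_one, ihp]
        rcases hmem.1 hp with h1 | h2
        · have h2 : p ≠ edgeOther σ.pos e := by rw [h1]; exact hq.symm
          tauto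
        · have h1 : p ≠ σ.pos := by rw [h2]; exact hq
          tauto
      · rw [if_neg hp, add_zero, ihp]
        have h1 : p ≠ σ.pos := fun h => hp (h ▸ hpe)
        have h2 : p ≠ edgeOther σ.pos e := fun h => hp (h ▸ edgeOther_mem hpe)
        tauto
    · rw [hs]; exact ih p

/-! ### Progress and halting -/

/-- While the walk has not halted, every step has traversed a new pair: `#trav_n = n`. [folklore] -/
theorem card_trav_eq_of_halt_eq_false (hrk : Set.InjOn rk ↑E) {F : Finset (Sym2 W)} {T : Finset W} {v : W} {n : ℕ}
    (h : (ewIter E rk F T (ewInit v) n).halt = false) : #(ewIter E rk F T (ewInit v) n).trav = n := by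
  induction n with
  | zero => simp [ewInit]
  | succ n ih =>
    set σ := ewIter E rk F T (ewInit v) n with hσ
    have hn : σ.halt = false := by rw [hσ]; exact halt_eq_false_of_le (Nat.le_succ n) h
    rw [ewIter_succ, ← hσ] at h ⊢
    rcases ewStep_cases (E := E) (rk := rk) F T σ with ⟨hh, hs⟩ | ⟨-, -, hs⟩ | ⟨hh, hT, hA, hs⟩ | ⟨-, -, -, hs⟩
    · rw [hn] at hh; exact absurd hh Bool.false_ne_true
    · rw [hs] at h; simp at h
    · obtain ⟨hstep, -, -, heU, -, -⟩ := ewStep_traverse_spec (E := E) (rk := rk) hh hT hA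
      rw [hstep]
      have hI := ewInv_iter hrk T (ewInv_init (E := E) F v) n
      rw [← hσ] at hI
      simp only [ewAdvance]
      rw [card_insert_of_notMem (fun h' => heU (hI.2 h')), ih hn]
    · rw [hs] at h
      simp [ewStuck] at h

/-- A walk that has not halted at time `n` has `n ≤ |E|`. [folklore] -/
theorem le_card_of_halt_eq_false (hrk : Set.InjOn rk ↑E) {F : Finset (Sym2 W)} {T : Finset W} {v : W} {n : ℕ}
    (h : (ewIter E rk F T (ewInit v) n).halt = false) : n ≤ E.card := by
  have hI := ewInv_iter hrk T (ewInv_init (E := E) F v) n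
  rw [← card_trav_eq_of_halt_eq_false hrk h]
  exact card_le_card (hI.2.trans hI.3)

/-- **The walk halts**: after `|E| + 1` steps the halting flag is set. [cite: AizenmanFernandezJSP1986, §4.1, Definition 4.2 (P3)] -/
theorem ewRun_halt (hrk : Set.InjOn rk ↑E) (F : Finset (Sym2 W)) (T : Finset W) (v : W) :
    (ewRun E rk F T v).halt = true := by
  by_contra h
  rw [Bool.not_eq_true] at h
  have := le_card_of_halt_eq_false (T := T) hrk h
  omega

/-- States beyond the horizon are the final state. [folklore] -/
theorem ewIter_eq_ewRun_of_le (hrk : Set.InjOn rk ↑E) (F : Finset (Sym2 W)) (T : Finset W) (v : W) {n : ℕ}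
    (hn : E.card + 1 ≤ n) : ewIter E rk F T (ewInit v) n = ewRun E rk F T v :=
  ewIter_eq_of_halt (ewRun_halt hrk F T v) hn

/-- **The first halting time**: there is `n₀ ≤ |E|` such that the walk has not halted at `n₀`, and the
state at `n₀ + 1` is the (halted) final state. [folklore] -/
theorem exists_halting_time (hrk : Set.InjOn rk ↑E) (F : Finset (Sym2 W)) (T : Finset W) (v : W) :
    ∃ n₀ ≤ E.card, (ewIter E rk F T (ewInit v) n₀).halt = false ∧
      ewIter E rk F T (ewInit v) (n₀ + 1) = ewRun E rk F T v := by
  classical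
  have hex : ∃ n, (ewIter E rk F T (ewInit v) n).halt = true := ⟨_, ewRun_halt hrk F T v⟩
  set N := Nat.find hex with hN
  have hNh : (ewIter E rk F T (ewInit v) N).halt = true := Nat.find_spec hex
  have hN0 : N ≠ 0 := by
    intro h0
    rw [h0] at hNh
    simp [ewInit] at hNh
  obtain ⟨n₀, hn₀N⟩ := Nat.exists_eq_succ_of_ne_zero hN0
  rw [hn₀N] at hNh
  have hn₀ : (ewIter E rk F T (ewInit v) n₀).halt = false := by
    have := Nat.find_min hex (show n₀ < N by omega)
    rwa [Bool.not_eq_true] at this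
  refine ⟨n₀, le_card_of_halt_eq_false hrk hn₀, hn₀, ?_⟩
  have hle : n₀ + 1 ≤ E.card + 1 := Nat.succ_le_succ (le_card_of_halt_eq_false hrk hn₀)
  rw [ewRun, ewIter_eq_of_halt hNh hle]

/-- **Definition 4.2 (P3): "This always happens at a source."** If every vertex of odd `F ∩ E`-degree
other than the start `v` is a stopping vertex, and `v` itself has odd degree or is a stopping vertex,
then the walk from `v` ends at a stopping vertex (it cannot get stuck elsewhere: at a stuck vertex
all pairs of `F` are traversed, and the traversed pairs form a trail). [cite: AizenmanFernandezJSP1986, §4.1, Definition 4.2 (P3)] -/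
theorem ewRun_pos_mem (hrk : Set.InjOn rk ↑E) (hE : ∀ e ∈ E, ¬(e : Sym2 W).IsDiag) {F : Finset (Sym2 W)}
    {T : Finset W} {v : W}
    (hsrc : ∀ p, Odd #((F ∩ E).filter fun e => p ∈ e) → p = v ∨ p ∈ T)
    (hv : Odd #((F ∩ E).filter fun e => v ∈ e) ∨ v ∈ T) :
    (ewRun E rk F T v).pos ∈ T := by
  obtain ⟨n₀, -, hn₀, hrun⟩ := exists_halting_time hrk F T v
  set σ := ewIter E rk F T (ewInit v) n₀ with hσ
  rw [← hrun, ewIter_succ, ← hσ]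
  rcases ewStep_cases (E := E) (rk := rk) F T σ with ⟨hh, hs⟩ | ⟨-, hT, hs⟩ | ⟨hh, hT, hA, hs⟩ | ⟨-, hT, hA, hs⟩
  · rw [hn₀] at hh; exact absurd hh Bool.false_ne_true
  · rw [hs]; exact hT
  · -- a traversing step does not halt
    exfalso
    have : (ewIter E rk F T (ewInit v) (n₀ + 1)).halt = false := by
      rw [ewIter_succ, ← hσ, (ewStep_traverse_spec hh hT hA).1]; rfl
    rw [hrun, ewRun_halt hrk] at this
    exact Bool.noConfusion this
  · -- stuck at `p = σ.pos ∉ T`: all pairs of `F ∩ E` at `p` are traversed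
    exfalso
    have hI := ewInv_iter hrk T (ewInv_init (E := E) F v) n₀
    rw [← hσ] at hI
    have hset : (F ∩ E).filter (fun e => σ.pos ∈ e) = σ.trav.filter (fun e => σ.pos ∈ e) := by
      ext e
      simp only [mem_filter, mem_inter]
      constructor
      · rintro ⟨⟨heF, heE⟩, hpe⟩
        refine ⟨hI.4 e ?_ heF, hpe⟩
        by_contra heU
        exact hA ⟨e, mem_ewAvail.2 ⟨⟨heE, hpe, heU⟩, heF⟩⟩
      · rintro ⟨heT, hpe⟩
        exact ⟨⟨hI.1 heT, hI.3 (hI.2 heT)⟩, hpe⟩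
    have hpar := odd_travDeg_iff hrk hE F T v n₀ σ.pos
    rw [← hσ] at hpar
    simp only [travDeg, ← hset, iff_true] at hpar
    -- `hpar : Odd #(...) ↔ ¬(σ.pos = v)`
    by_cases hpv : σ.pos = v
    · -- `v` has even degree, so `v ∈ T`, contradiction
      rcases hv with hodd | hvT
      · rw [← hpv] at hodd; exact (hpar.1 hodd) hpv
      · exact hT (hpv ▸ hvT)
    · rcases hsrc σ.pos (hpar.2 hpv) with h | h
      · exact hpv h
      · exact hT h

/-! ### Visited vertices and traversed pairs -/

/-- The start is visited. [folklore] -/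
theorem ewIter_pos_zero (F : Finset (Sym2 W)) (T : Finset W) (v : W) : (ewIter E rk F T (ewInit v) 0).pos = v := rfl

/-- **Both ends of a traversed pair are visited**: if `e` is traversed by time `n`, each endpoint of
`e` is the current vertex at some time `≤ n`. [folklore] -/
theorem exists_pos_eq_of_mem_trav {F : Finset (Sym2 W)} {T : Finset W} {v : W} {n : ℕ}
    {e : Sym2 W} (he : e ∈ (ewIter E rk F T (ewInit v) n).trav) {w : W} (hw : w ∈ e) :
    ∃ m ≤ n, (ewIter E rk F T (ewInit v) m).pos = w := by
  induction n with
  | zero => simp [ewInit] at he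
  | succ n ih =>
    set σ := ewIter E rk F T (ewInit v) n with hσ
    rw [ewIter_succ, ← hσ] at he
    rcases ewStep_cases (E := E) (rk := rk) F T σ with ⟨-, hs⟩ | ⟨-, -, hs⟩ | ⟨hh, hT, hA, hs⟩ | ⟨-, -, -, hs⟩
    · rw [hs] at he
      obtain ⟨m, hm, h⟩ := ih he
      exact ⟨m, hm.trans (Nat.le_succ n), h⟩
    · rw [hs] at he
      obtain ⟨m, hm, h⟩ := ih he
      exact ⟨m, hm.trans (Nat.le_succ n), h⟩
    · obtain ⟨hstep, -, hpe, -, -, -⟩ := ewStep_traverse_spec (E := E) (rk := rk) hh hT hA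
      rw [hstep] at he
      simp only [ewAdvance, mem_insert] at he
      rcases he with rfl | he
      · rcases (mem_iff_eq_or_eq_edgeOther hpe w).1 hw with rfl | rfl
        · exact ⟨n, Nat.le_succ n, rfl⟩
        · refine ⟨n + 1, le_rfl, ?_⟩
          rw [ewIter_succ, ← hσ, hstep]; rfl
      · obtain ⟨m, hm, h⟩ := ih he
        exact ⟨m, hm.trans (Nat.le_succ n), h⟩
    · rw [hs] at he
      simp only [ewStuck] at he
      obtain ⟨m, hm, h⟩ := ih he
      exact ⟨m, hm.trans (Nat.le_succ n), h⟩

/-! ### Surgery: removing the pair traversed from `a` -/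

/-- **Surgery lemma** (the step behind Prop. 4.6, eq. (4.21), "splitting from the paths their last
step"): suppose that at time `i` the walk of `F` (stopping set `T`) sits, unhalted, at `a ∉ T` and
traverses the pair `e`. Then the walk of `F ∖ {e}` with stopping set `T ∪ {a}` ends at `a`: up to the
first visit of `a` the two walks agree (the pair `e` is first examined at that very moment from `a`),
and there the second walk stops. [cite: AizenmanFernandezJSP1986, §4.3, proof of Prop. 4.6, eq. (4.21)] -/
theorem ewRun_erase_pos_eq (hrk : Set.InjOn rk ↑E) {F : Finset (Sym2 W)} {T : Finset W} {v a : W} {i : ℕ}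
    (hh : (ewIter E rk F T (ewInit v) i).halt = false) (ha : (ewIter E rk F T (ewInit v) i).pos = a) (haT : a ∉ T)
    (hA : (ewAvail E F (ewIter E rk F T (ewInit v) i)).Nonempty) :
    (ewRun E rk (F.erase (Function.argminOn rk (↑(ewAvail E F (ewIter E rk F T (ewInit v) i)) : Set (Sym2 W)) hA))
      (insert a T) v).pos = a := by
  classical
  set σi := ewIter E rk F T (ewInit v) i with hσi
  set e := Function.argminOn rk (↑(ewAvail E F σi) : Set (Sym2 W)) hA with he
  have hspec := ewStep_traverse_spec (E := E) (rk := rk) (T := T) hh (ha ▸ haT : σi.pos ∉ T) hA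
  rw [← he] at hspec
  obtain ⟨hstep, heE, hae, heU, heF, hmin⟩ := hspec
  -- the first visit of `a`
  have hex : ∃ n, (ewIter E rk F T (ewInit v) n).pos = a := ⟨i, ha⟩
  set j := Nat.find hex with hj
  have hja : (ewIter E rk F T (ewInit v) j).pos = a := Nat.find_spec hex
  have hji : j ≤ i := Nat.find_min' hex ha
  have hbefore : ∀ m < j, (ewIter E rk F T (ewInit v) m).pos ≠ a := fun m hm => Nat.find_min hex hm
  -- the two walks agree up to time `j`
  have hagree : ∀ m ≤ j, ewIter E rk (F.erase e) (insert a T) (ewInit v) m = ewIter E rk F T (ewInit v) m := by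
    intro m hm
    induction m with
    | zero => rfl
    | succ m ih =>
      have hm' : m < j := hm
      set σ := ewIter E rk F T (ewInit v) m with hσ
      have ihm := ih hm'.le
      rw [ewIter_succ, ewIter_succ, ihm, ← hσ]
      have hσh : σ.halt = false := by rw [hσ]; exact halt_eq_false_of_le (hm'.le.trans hji) hh
      have hσa : σ.pos ≠ a := by rw [hσ]; exact hbefore m hm'
      -- the `F`-walk does not halt at `m + 1 ≤ j ≤ i`, so `σ.pos ∉ T`
      have hσT : σ.pos ∉ T := by
        intro hT
        have h1 : (ewIter E rk F T (ewInit v) (m + 1)).halt = true := by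
          rw [ewIter_succ, ← hσ, ewStep_of_mem hσh hT]
        have h2 : (ewIter E rk F T (ewInit v) (m + 1)).halt = false := halt_eq_false_of_le (hm.trans hji) hh
        rw [h1] at h2; exact Bool.noConfusion h2
      have hσT' : σ.pos ∉ insert a T := by rw [mem_insert, not_or]; exact ⟨hσa, hσT⟩
      -- compare the available pairs
      have havail : ewAvail E (F.erase e) σ = (ewAvail E F σ).erase e := by
        ext e'; simp only [mem_ewAvail, mem_erase]; tauto
      rcases ewStep_cases (E := E) (rk := rk) F T σ with ⟨hh', _⟩ | ⟨-, hT', _⟩ | ⟨-, -, hA', hs⟩ | ⟨-, -, hA', hs⟩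
      · rw [hσh] at hh'; exact absurd hh' Bool.false_ne_true
      · exact absurd hT' hσT
      · -- traversing step with chosen pair `c`
        set c := Function.argminOn rk (↑(ewAvail E F σ) : Set (Sym2 W)) hA' with hc
        have hcA := argminOn_mem_ewAvail (E := E) (rk := rk) hA'
        rw [← hc] at hcA
        have hce : c ≠ e := by
          intro hceq
          -- then `e` is traversed at time `m`, so it is cancelled at time `i`, contradiction
          have htrav : e ∈ (ewIter E rk F T (ewInit v) (m + 1)).trav := by
            rw [ewIter_succ, ← hσ, hs]; simp [ewAdvance, hceq]
          have hI := ewInv_iter hrk T (ewInv_init (E := E) F v) i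
          have htrav_i := trav_mono_ewIter F T (ewInit v) (hm.trans hji) htrav
          rw [← hσi] at htrav_i hI
          exact heU (hI.2 htrav_i)
        have hcA' : c ∈ ewAvail E (F.erase e) σ := by rw [havail]; exact mem_erase.2 ⟨hce, hcA⟩
        have hA'' : (ewAvail E (F.erase e) σ).Nonempty := ⟨c, hcA'⟩
        rw [hs, ewStep_of_nonempty hσh hσT' hA'']
        suffices heq : Function.argminOn rk (↑(ewAvail E (F.erase e) σ) : Set (Sym2 W)) hA'' = c by rw [heq]
        set c' := Function.argminOn rk (↑(ewAvail E (F.erase e) σ) : Set (Sym2 W)) hA'' with hc'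
        have hc'A := argminOn_mem_ewAvail (E := E) (rk := rk) hA''
        rw [← hc'] at hc'A
        have h1 : rk c' ≤ rk c := by rw [hc']; exact rk_argminOn_le hA'' hcA'
        have hc'F : c' ∈ ewAvail E F σ := by rw [havail] at hc'A; exact (mem_erase.1 hc'A).2
        have h2 : rk c ≤ rk c' := by rw [hc]; exact rk_argminOn_le hA' hc'F
        exact hrk (mem_ewAvail.1 hc'A).1.1 (mem_ewAvail.1 hcA).1.1 (le_antisymm h1 h2)
      · -- stuck for `F`: also stuck for `F ∖ {e}`
        have hA'' : ¬(ewAvail E (F.erase e) σ).Nonempty := by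
          rw [havail]; rintro ⟨e', he'⟩; exact hA' ⟨e', (mem_erase.1 he').2⟩
        rw [hs, ewStep_of_empty hσh hσT' hA'']
  -- at time `j` the second walk is at `a` and stops there
  have hj' := hagree j le_rfl
  have hjh : (ewIter E rk F T (ewInit v) j).halt = false := halt_eq_false_of_le hji hh
  have hnext : ewIter E rk (F.erase e) (insert a T) (ewInit v) (j + 1) =
      { ewIter E rk F T (ewInit v) j with halt := true } := by
    rw [ewIter_succ, hj', ewStep_of_mem hjh (by rw [hja]; exact mem_insert_self a T)]
  have hhalt : (ewIter E rk (F.erase e) (insert a T) (ewInit v) (j + 1)).halt = true := by rw [hnext]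
  have hle : j + 1 ≤ E.card + 1 := Nat.succ_le_succ (hji.trans (le_card_of_halt_eq_false hrk hh))
  rw [ewRun, ewIter_eq_of_halt hhalt hle, hnext]
  exact hja

end EdgeWalk


end Literature.Probability.LatticeModels
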